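import Summits.CriticalPhenomena.CardyFormulaZ2.Theorems.CardyIKTransportIKLinearTransportStubCouplingToLimitsEvents
import Summits.CriticalPhenomena.CardyFormulaZ2.Theorems.CardyIKTransportIKQuarterTurnBijection
import Literature.Probability.LatticeModels.CellGridSaddlePercolationProofs
import Literature.Probability.Percolation.CornerPercolation
import Summits.CriticalPhenomena.CardyFormulaZ2.Theorems.CardyIKTransportIKMixedBoxCrossingDefs

/-!
# Stub `stub_duality` (line `paired-mirror-exploration`, crux `IKMixedBoxCrossing`, stmt-CriticalPhenomena-5911)

Support file (`--supports stmt-CriticalPhenomena-5911`): the exact SELF-DUALITY of the column-mixed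
plaquette colouring field on boxes,

  `P_S[black LR crossing of the w × h box] + P_S[black TB crossing of the w × h box] = 1`  (`w, h ≥ 2`),

for every column pattern `S` and every position `(a, b)` (`stub_duality`, registered signature).

Proof.
* POINTWISE DUALITY (`xor_lrCross_tbCross`): for every observable configuration `x = (black cells,
  anti-diagonal faces)`, exactly one of "`x` has a black LR crossing of the box" and "the colour-flipped
  configuration `(x.1ᶜ, x.2)` has a black TB crossing of the box" holds.  This is the tree's Hex lemma
  `cellCrossing_duality_holds` for the cell grid with saddle coins, read through the DICTIONARY
  (translation by `(a, b)`: colouring `σ v = [v + (a,b) black]`, coin `κ f = [f + (a,b) ∉ anti-diagonal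
  set]`): the coin-selected triangulation of the translated configuration is the translate of the random
  triangulation `cellGraph x.2` of the gauge (`cellGraph_coins_adj_iff`), and for boxes of width (resp. height)
  `≥ 2` the bond reading of a crossing (`openCrossing` of `blackEdges x`) agrees with the site reading
  (`PathIn` of black cells; `pathIn_of_mem_openConnIn`, `mem_openConnIn_of_pathIn`).
* COLOUR FLIP `ω ↦ (ω.1ᶜ, ω.2)` (`measurePreserving_flipCol`, `obs_flipCol`): complementing the column signs
  preserves `μIK` (`IKQuarterTurn.measurePreserving_compl_int`) and complements the black set while
  keeping the anti-diagonal set; so the flipped TB event has the probability of the TB event and is the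
  complement of the LR event, whence the two probabilities add up to `1` (`μIK` is a probability measure).
-/

noncomputable section

namespace Summit.CriticalPhenomena.CardyFormulaZ2.Cruxes.IKMixedBoxCrossing.PairedMirrorExploration

open scoped Classical
open MeasureTheory
open Literature.Probability.Percolation Literature.Probability.LatticeModels
open Summit.CriticalPhenomena.CardyFormulaZ2.Theorems.IKLinearTransport.PinnedDiagramExchange
  (Ω μIK parSet blackSet antiSet Obs obs νmix blackEdges lrCross tbCross)
open Summit.CriticalPhenomena.CardyFormulaZ2.Theorems.IKLinearTransport.PinnedDiagramExchange
  renaming cellGraph → obsGraph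
open Summit.CriticalPhenomena.CardyFormulaZ2.Theorems.IKLinearTransport.PinnedDiagramExchange.CouplingToLimits

namespace DualityStub

/-! ## §1 Bond reading versus site reading of black paths -/

/-- A walk of the open graph of `blackEdges x` induced on `X` is traced by a chain of
`obsGraph x.2`-adjacent black cells of `X`; its first cell is black as soon as the walk moves. [folklore] -/
theorem reflTransGen_of_walk {x : Obs} {X : Set (Site 2)} {s t : X}
    (p : ((openGraph (blackEdges x)).induce X).Walk s t) :
    Relation.ReflTransGen (fun u v => (obsGraph x.2).Adj u v ∧ v ∈ X ∩ x.1) s.1 t.1 ∧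
      (s.1 ≠ t.1 → s.1 ∈ x.1) := by
  induction p with
  | nil => exact ⟨Relation.ReflTransGen.refl, fun h => absurd rfl h⟩
  | @cons a b _ h _ ih =>
    have h' : (openGraph (blackEdges x)).Adj a.1 b.1 := h
    obtain ⟨hadj, ha, hb⟩ := adj_of_mk_mem_blackEdges ((openGraph_adj _ _ _).1 h').1
    exact ⟨Relation.ReflTransGen.head ⟨hadj, b.2, hb⟩ ih.1, fun _ => ha⟩

/-- BOND → SITE: an open path of `blackEdges x` inside `X` between two DISTINCT cells is a path of black
cells of `X` in the triangulation `obsGraph x.2`. [folklore] -/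
theorem pathIn_of_mem_openConnIn {x : Obs} {X : Set (Site 2)} {u v : Site 2} (huv : u ≠ v)
    (h : blackEdges x ∈ openConnIn X u v) : PathIn (obsGraph x.2) (X ∩ x.1) u v := by
  obtain ⟨hu, _hv, ⟨p⟩⟩ := h
  have h := reflTransGen_of_walk p
  exact ⟨⟨hu, h.2 huv⟩, h.1⟩

/-- SITE → BOND: a path of black cells of `X` in `obsGraph x.2` is an open path of `blackEdges x`
inside `X`. [folklore] -/
theorem mem_openConnIn_of_pathIn {x : Obs} {X : Set (Site 2)} {u v : Site 2}
    (h : PathIn (obsGraph x.2) (X ∩ x.1) u v) : blackEdges x ∈ openConnIn X u v := by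
  obtain ⟨hu, h⟩ := h
  induction h with
  | refl => exact ⟨hu.1, hu.1, SimpleGraph.Reachable.refl _⟩
  | @tail b c hub hbc ih =>
    obtain ⟨huX, hbX, hreach⟩ := ih
    have hb : b ∈ X ∩ x.1 := PathIn.right_mem ⟨hu, hub⟩
    have hedge : (openGraph (blackEdges x)).Adj b c :=
      (openGraph_adj _ _ _).2 ⟨mk_mem_blackEdges_of_adj hbc.1 hb.2 hbc.2.2, hbc.1.ne⟩
    have hadj : ((openGraph (blackEdges x)).induce X).Adj ⟨b, hbX⟩ ⟨c, hbc.2.1⟩ := hedge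
    exact ⟨huX, hbc.2.1, hreach.trans hadj.reachable⟩

/-- Transport of `PathIn` along a map respecting adjacency and the vertex sets. [folklore] -/
theorem pathIn_map {V W : Type*} {G : SimpleGraph V} {G' : SimpleGraph W} {A : Set V} {A' : Set W}
    (f : V → W) (hadj : ∀ a b, G.Adj a b → G'.Adj (f a) (f b)) (hA : ∀ a ∈ A, f a ∈ A') {u v : V}
    (h : PathIn G A u v) : PathIn G' A' (f u) (f v) := by
  obtain ⟨hu, h⟩ := h
  refine ⟨hA u hu, ?_⟩
  induction h with
  | refl => exact Relation.ReflTransGen.refl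
  | tail _ hbc ih => exact ih.tail ⟨hadj _ _ hbc.1, hA _ hbc.2⟩

/-! ## §2 The dictionary with the cell grid with saddle coins -/

/-- Black cells of the translated cell configuration `(σ, κ)`, `σ v = [v + c ∈ B]`, are the translated
cells of `B`. [folklore] -/
theorem mem_black_cell {c : Site 2} {B : Set (Site 2)} {κ : Site 2 → Bool} {p : Site 2} :
    p ∈ CellConfig.black (fun v => decide (v + c ∈ B), κ) ↔ p + c ∈ B := by
  simp [CellConfig.black]

/-- White cells of the translated cell configuration are the translated cells off `B`. [folklore] -/
theorem mem_white_cell {c : Site 2} {B : Set (Site 2)} {κ : Site 2 → Bool} {p : Site 2} :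
    p ∈ CellConfig.white (fun v => decide (v + c ∈ B), κ) ↔ p + c ∉ B := by
  simp [CellConfig.white]

/-- DICTIONARY OF TRIANGULATIONS: with the saddle coins `κ f = [f + c ∉ F]` read off the anti-diagonal
set `F` in the frame with origin `c` (`κ f = true`, the NE–SW diagonal, iff the face `f + c` does NOT
carry the anti-diagonal), the coin-selected triangulation `cellGraph κ` of the cell grid is the translate
by `-c` of the random triangulation `obsGraph F` of the gauge. [folklore] -/
theorem cellGraph_coins_adj_iff (c : Site 2) (F : Set (Site 2)) (p q : Site 2) :
    (cellGraph fun f => decide (f + c ∉ F)).Adj p q ↔ (obsGraph F).Adj (p + c) (q + c) := by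
  have he₀ : (Pi.single 0 1 : Site 2) = ![1, 0] := by
    ext i; fin_cases i <;> simp
  have he₁ : (Pi.single 1 1 : Site 2) = ![0, 1] := by
    ext i; fin_cases i <;> simp
  have h₁ : (1 : Site 2) = ![1, 1] := by
    ext i; fin_cases i <;> simp
  have hneg : -(![0, 1] : Site 2) = ![0, -1] := by
    ext i; fin_cases i <;> rfl
  have key : ∀ r : Site 2, r - ![0, 1] + c = r + c + ![0, -1] := fun r => by
    rw [sub_eq_add_neg, add_right_comm, hneg]
  have hcancel : ∀ r r' e : Site 2, (r + c = r' + c + e ↔ r = r' + e) := fun r r' e => by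
    rw [add_right_comm, add_left_inj]
  simp only [cellGraph, obsGraph, SimpleGraph.fromRel_adj, zdGraph_adj_iff, Fin.exists_fin_two,
    cellDiagRel, decide_eq_true_eq, decide_eq_false_iff_not, not_not, he₀, he₁, h₁, triDiag, key,
    hcancel, ne_eq, add_left_inj]
  tauto

/-- Frame change, gauge frame → cell frame, for paths. [folklore] -/
theorem pathIn_sub (c : Site 2) {F A A' : Set (Site 2)} (hA : ∀ v ∈ A, v - c ∈ A') {u v : Site 2}
    (h : PathIn (obsGraph F) A u v) :
    PathIn (cellGraph fun f => decide (f + c ∉ F)) A' (u - c) (v - c) :=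
  pathIn_map (· - c) (fun p q hpq => (cellGraph_coins_adj_iff c F _ _).2
    (by simpa only [sub_add_cancel] using hpq)) hA h

/-- Frame change, cell frame → gauge frame, for paths. [folklore] -/
theorem pathIn_add (c : Site 2) {F A' A : Set (Site 2)} (hA : ∀ p ∈ A', p + c ∈ A) {p q : Site 2}
    (h : PathIn (cellGraph fun f => decide (f + c ∉ F)) A' p q) : PathIn (obsGraph F) A (p + c) (q + c) :=
  pathIn_map (· + c) (fun p q hpq => (cellGraph_coins_adj_iff c F p q).1 hpq) hA h

/-! ## §3 Box crossings through the dictionary -/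

/-- BLACK LR CROSSINGS: for a box of width `m + 1 ≥ 2`, the gauge's black LR crossing of
`[a, a+m] × [b, b+n]` (bond reading) is the cell grid's `cellLRCrossing m n` of the translated
configuration (colouring `σ v = [v + (a,b) ∈ x.1]`, coins `κ f = [f + (a,b) ∉ x.2]`). [folklore] -/
theorem mem_lrCross_iff {x : Obs} {a b : ℤ} {m n : ℕ} (hm : 1 ≤ m) :
    x ∈ lrCross a b (m + 1) (n + 1) ↔
      ((fun v => decide (v + ![a, b] ∈ x.1), fun f => decide (f + ![a, b] ∉ x.2)) : CellConfig) ∈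
        cellLRCrossing m n := by
  simp only [lrCross, Set.mem_setOf_eq, mem_openCrossing_iff, mem_cellLRCrossing_iff,
    mem_cellConnIn_iff_pathIn]
  constructor
  · rintro ⟨u, ⟨hu0, hu1, hu2⟩, v, ⟨hv0, hv1, hv2⟩, huv⟩
    have hne : u ≠ v := by
      rintro rfl; omega
    refine ⟨u - ![a, b], ?_, v - ![a, b], ?_, pathIn_sub _ ?_ (pathIn_of_mem_openConnIn hne huv)⟩
    · simp only [leftSide, Finset.mem_filter, mem_rectangle_iff, Pi.sub_apply, Matrix.cons_val_zero,
        Matrix.cons_val_one, Matrix.cons_val_fin_one]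
      omega
    · simp only [rightSide, Finset.mem_filter, mem_rectangle_iff, Pi.sub_apply, Matrix.cons_val_zero,
        Matrix.cons_val_one, Matrix.cons_val_fin_one]
      omega
    · rintro z ⟨hz, hzB⟩
      simp only [Set.mem_setOf_eq] at hz
      refine ⟨?_, mem_black_cell.2 (by rwa [sub_add_cancel])⟩
      simp only [Finset.mem_coe, mem_rectangle_iff, Pi.sub_apply, Matrix.cons_val_zero,
        Matrix.cons_val_one, Matrix.cons_val_fin_one]
      omega
  · rintro ⟨p, hp, q, hq, hpq⟩
    simp only [leftSide, rightSide, Finset.mem_filter, mem_rectangle_iff] at hp hq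
    refine ⟨p + ![a, b], ?_, q + ![a, b], ?_, mem_openConnIn_of_pathIn (pathIn_add _ ?_ hpq)⟩
    · simp only [Pi.add_apply, Matrix.cons_val_zero, Matrix.cons_val_one, Matrix.cons_val_fin_one]
      omega
    · simp only [Pi.add_apply, Matrix.cons_val_zero, Matrix.cons_val_one, Matrix.cons_val_fin_one]
      omega
    · rintro z ⟨hz, hzB⟩
      simp only [Finset.mem_coe, mem_rectangle_iff] at hz
      refine ⟨?_, mem_black_cell.1 hzB⟩
      simp only [Set.mem_setOf_eq, Pi.add_apply, Matrix.cons_val_zero, Matrix.cons_val_one,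
        Matrix.cons_val_fin_one]
      omega

/-- WHITE TB CROSSINGS: for a box of height `n + 1 ≥ 2`, the black TB crossing of the COLOUR-FLIPPED
configuration `(x.1ᶜ, x.2)` (bond reading) is the cell grid's white TB crossing `cellTBCrossingWhite m n`
of the translated configuration. [folklore] -/
theorem compl_mem_tbCross_iff {x : Obs} {a b : ℤ} {m n : ℕ} (hn : 1 ≤ n) :
    (x.1ᶜ, x.2) ∈ tbCross a b (m + 1) (n + 1) ↔
      ((fun v => decide (v + ![a, b] ∈ x.1), fun f => decide (f + ![a, b] ∉ x.2)) : CellConfig) ∈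
        cellTBCrossingWhite m n := by
  simp only [tbCross, Set.mem_setOf_eq, mem_openCrossing_iff, mem_cellTBCrossingWhite_iff,
    mem_cellConnIn_iff_pathIn, CellConfig.swap_snd, CellConfig.black_swap]
  constructor
  · rintro ⟨u, ⟨hu0, hu1, hu2⟩, v, ⟨hv0, hv1, hv2⟩, huv⟩
    have hne : u ≠ v := by
      rintro rfl; omega
    have hpath := pathIn_of_mem_openConnIn hne huv
    refine ⟨u - ![a, b], ?_, v - ![a, b], ?_, pathIn_sub _ ?_ hpath⟩
    · simp only [bottomSide, Finset.mem_filter, mem_rectangle_iff, Pi.sub_apply, Matrix.cons_val_zero,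
        Matrix.cons_val_one, Matrix.cons_val_fin_one]
      omega
    · simp only [topSide, Finset.mem_filter, mem_rectangle_iff, Pi.sub_apply, Matrix.cons_val_zero,
        Matrix.cons_val_one, Matrix.cons_val_fin_one]
      omega
    · rintro z ⟨hz, hzB⟩
      simp only [Set.mem_setOf_eq] at hz
      refine ⟨?_, mem_white_cell.2 (by rw [sub_add_cancel]; exact hzB)⟩
      simp only [Finset.mem_coe, mem_rectangle_iff, Pi.sub_apply, Matrix.cons_val_zero,
        Matrix.cons_val_one, Matrix.cons_val_fin_one]
      omega
  · rintro ⟨p, hp, q, hq, hpq⟩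
    simp only [bottomSide, topSide, Finset.mem_filter, mem_rectangle_iff] at hp hq
    refine ⟨p + ![a, b], ?_, q + ![a, b], ?_,
      mem_openConnIn_of_pathIn (x := (x.1ᶜ, x.2)) (pathIn_add _ ?_ hpq)⟩
    · simp only [Pi.add_apply, Matrix.cons_val_zero, Matrix.cons_val_one, Matrix.cons_val_fin_one]
      omega
    · simp only [Pi.add_apply, Matrix.cons_val_zero, Matrix.cons_val_one, Matrix.cons_val_fin_one]
      omega
    · rintro z ⟨hz, hzB⟩
      simp only [Finset.mem_coe, mem_rectangle_iff] at hz
      refine ⟨?_, mem_white_cell.1 hzB⟩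
      simp only [Set.mem_setOf_eq, Pi.add_apply, Matrix.cons_val_zero, Matrix.cons_val_one,
        Matrix.cons_val_fin_one]
      omega

/-- POINTWISE DUALITY (Hex lemma, `cellCrossing_duality_holds`, through the dictionary): for every
observable configuration and every box of width and height `≥ 2`, exactly one of "black LR crossing"
and "black TB crossing after the colour flip" holds. [folklore] -/
theorem xor_lrCross_tbCross (x : Obs) (a b : ℤ) {m n : ℕ} (hm : 1 ≤ m) (hn : 1 ≤ n) :
    Xor (x ∈ lrCross a b (m + 1) (n + 1)) ((x.1ᶜ, x.2) ∈ tbCross a b (m + 1) (n + 1)) := by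
  rw [mem_lrCross_iff hm, compl_mem_tbCross_iff hn]
  exact cellCrossing_duality_holds m n hn _

/-! ## §4 The colour flip and the measure identity -/

/-- The colour flip `ω ↦ (ω.1ᶜ, ω.2)` (complement the column signs) preserves the gauge measure. [folklore] -/
theorem measurePreserving_flipCol : MeasurePreserving (fun ω : Ω => (ω.1ᶜ, ω.2)) μIK μIK := by
  have h : (fun ω : Ω => (ω.1ᶜ, ω.2)) = Prod.map compl id := funext fun ω => rfl
  rw [h]
  unfold μIK
  exact Theorems.IKQuarterTurn.measurePreserving_compl_int.prod (MeasurePreserving.id _)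

/-- The colour flip complements the black set. [folklore] -/
theorem blackSet_flipCol (S : Set ℤ) (ω : Ω) : blackSet S (ω.1ᶜ, ω.2) = (blackSet S ω)ᶜ := by
  ext v
  simp only [blackSet, parSet, Set.mem_setOf_eq, Set.mem_compl_iff, xor_not_left, not_xor]

/-- The colour flip on observables: black cells complemented, anti-diagonal faces unchanged. [folklore] -/
theorem obs_flipCol (S : Set ℤ) (ω : Ω) : obs S (ω.1ᶜ, ω.2) = ((obs S ω).1ᶜ, (obs S ω).2) :=
  Prod.ext (blackSet_flipCol S ω) rfl

/-- The LR crossing event of observables is measurable. [folklore] -/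
theorem measurableSet_lrCross (a b : ℤ) (w h : ℕ) : MeasurableSet (lrCross a b w h) := by
  unfold lrCross
  exact measurable_blackEdges (measurableSet_openCrossing_of_countable _ _ _)

/-- The TB crossing event of observables is measurable. [folklore] -/
theorem measurableSet_tbCross (a b : ℤ) (w h : ℕ) : MeasurableSet (tbCross a b w h) := by
  unfold tbCross
  exact measurable_blackEdges (measurableSet_openCrossing_of_countable _ _ _)

/-- SELF-DUALITY IN MEASURE: `μIK[LR] + μIK[TB] = 1` for boxes of width and height `≥ 2`. [folklore] -/
theorem real_lrCross_add_real_tbCross (S : Set ℤ) (a b : ℤ) {m n : ℕ} (hm : 1 ≤ m) (hn : 1 ≤ n) :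
    μIK.real (obs S ⁻¹' lrCross a b (m + 1) (n + 1)) +
      μIK.real (obs S ⁻¹' tbCross a b (m + 1) (n + 1)) = 1 := by
  haveI := isProbabilityMeasure_μIK
  have hE₁ : MeasurableSet (obs S ⁻¹' lrCross a b (m + 1) (n + 1)) :=
    measurable_obs S (measurableSet_lrCross a b _ _)
  have hE₂ : MeasurableSet (obs S ⁻¹' tbCross a b (m + 1) (n + 1)) :=
    measurable_obs S (measurableSet_tbCross a b _ _)
  have hflip : (fun ω : Ω => (ω.1ᶜ, ω.2)) ⁻¹' (obs S ⁻¹' tbCross a b (m + 1) (n + 1)) =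
      (obs S ⁻¹' lrCross a b (m + 1) (n + 1))ᶜ := by
    ext ω
    have hx := xor_lrCross_tbCross (obs S ω) a b hm hn
    simp only [Set.mem_preimage, Set.mem_compl_iff, obs_flipCol]
    rcases hx with ⟨h1, h2⟩ | ⟨h1, h2⟩
    · exact iff_of_false h2 (not_not_intro h1)
    · exact iff_of_true h1 h2
  have h2 : μIK.real (obs S ⁻¹' tbCross a b (m + 1) (n + 1)) =
      μIK.real (obs S ⁻¹' lrCross a b (m + 1) (n + 1))ᶜ := by
    rw [← hflip, measureReal_def, measureReal_def,
      measurePreserving_flipCol.measure_preimage hE₂.nullMeasurableSet]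
  rw [h2, measureReal_add_measureReal_compl hE₁, probReal_univ]

end DualityStub

/-- **STUB `stub_duality`** (registered signature): exact self-duality of the column-mixed model on
boxes, `P_S[LR(w × h)] + P_S[TB(w × h)] = 1` for `w, h ≥ 2`, every column pattern `S` and every
position `(a, b)` — the Hex lemma for the random triangulation plus the measure-preserving colour flip
of the column signs. [folklore] -/
theorem stub_duality :
    ∀ (S : Set ℤ) (a b : ℤ) (w h : ℕ), 2 ≤ w → 2 ≤ h → pLR S a b w h + pTB S a b w h = 1 := by
  intro S a b w h hw hh
  obtain ⟨m, rfl⟩ : ∃ m, w = m + 1 := ⟨w - 1, by omega⟩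
  obtain ⟨n, rfl⟩ : ∃ n, h = n + 1 := ⟨h - 1, by omega⟩
  exact DualityStub.real_lrCross_add_real_tbCross S a b (by omega) (by omega)

end Summit.CriticalPhenomena.CardyFormulaZ2.Cruxes.IKMixedBoxCrossing.PairedMirrorExploration

end
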